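import Mathlib
import Summits.KontsevichZagierPeriods.Zeta5Search.CellKitRays
import HarnessLib

/-!
# ζ(5) search — long classes of RAY #4, I: the net exponent of `b(n) = n·(34; 14,…,8)` by bracket (gen-2 g16)

Cell `pub-zeta5` (HONEST FRAMING: systematic search; no irrationality claim unless certified), GEN-2 seat generation 16.
The ray-#4 analogue of typer g13's `LongClassBrackets.lean` (record ray), for the ∀-`n` machines that will discharge the
ray-4 class-structure nodes `Ray4Windows.Ray4ClassesA4M56/M52`, `Ray4ShapeM52/M56`, `Ray4ShapesL5M52/M56/M102`
(`Ray4FrameL5.lean`, gen-2 g16's `Ray4WindowsA4` / `Ray4FrameL5K2`): the net exponent of the ray-4 datum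
`b(n) = n·(34; 14,13,12,11,10,9,8) = bLin (8n) (6n) n` at a position `s ≤ 34n` depends only on the BRACKET `β = ⌊s/n⌋`, on
whether `s` is a multiple of `n` (the right staircase is left-open), and on the even-centre flag `2s = 34n`:
`netExp (bLin (8n) (6n) n) s = brVal4 β [n ∣ s] + [2s = 34n]` (`netExp_ray4_eq`), with `brVal4` the explicit staircase profile
`1 (β ≤ 7), 8 − β (8..13), −6 (14..19), β − 25 (20..25), 1 (β ≥ 26)` (shifted by one bracket at exact multiples on the right).
This is the profile visible in the ray-4 deep types `T52R4` / `T56R4` / `T102R4`.  Integer bookkeeping from `CellKit.depL_*`;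
nothing here bears on irrationality.
-/

namespace Summit.KontsevichZagierPeriods.Zeta5Search.Ray4Windows

open Finset
open Summit.KontsevichZagierPeriods.Zeta5Search.ClusterValuation (netExp blockCount)
open Summit.KontsevichZagierPeriods.Zeta5Search.CellKit

/-- **The bracket profile of ray #4**: value of `netExp (bLin (8n) (6n) n)` on the bracket `β = ⌊s/n⌋` (`rz` = "`s` is a
multiple of `n`", which matters only on the right staircase `20 ≤ β ≤ 26`), without the even-centre term. -/
def brVal4 (β : ℕ) (rz : Bool) : ℤ :=
  if β ≤ 7 then 1 else if β ≤ 13 then 8 - (β : ℤ) else if β ≤ 19 then -6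
  else if rz then (if β ≤ 20 then -6 else if β ≤ 26 then (β : ℤ) - 26 else 1)
  else (if β ≤ 25 then (β : ℤ) - 25 else 1)

/-- The depth profile at an exact multiple `s = βn`, `β ≤ 34`. -/
theorem depth_ray4_mul {n β : ℕ} (hn : 1 ≤ n) (hβ : β ≤ 34) :
    1 - (blockCount (bLin (8 * n) (6 * n) n) (β * n) : ℤ) = brVal4 β true := by
  interval_cases β
  · rw [depL_low (by omega)]; norm_num [brVal4]
  · rw [depL_low (by omega)]; norm_num [brVal4]
  · rw [depL_low (by omega)]; norm_num [brVal4]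
  · rw [depL_low (by omega)]; norm_num [brVal4]
  · rw [depL_low (by omega)]; norm_num [brVal4]
  · rw [depL_low (by omega)]; norm_num [brVal4]
  · rw [depL_low (by omega)]; norm_num [brVal4]
  · rw [depL_low (by omega)]; norm_num [brVal4]
  · rw [depL_lower (k := 1) (by norm_num) (by norm_num) (by omega) (by omega)]; norm_num [brVal4]
  · rw [depL_lower (k := 2) (by norm_num) (by norm_num) (by omega) (by omega)]; norm_num [brVal4]
  · rw [depL_lower (k := 3) (by norm_num) (by norm_num) (by omega) (by omega)]; norm_num [brVal4]
  · rw [depL_lower (k := 4) (by norm_num) (by norm_num) (by omega) (by omega)]; norm_num [brVal4]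
  · rw [depL_lower (k := 5) (by norm_num) (by norm_num) (by omega) (by omega)]; norm_num [brVal4]
  · rw [depL_lower (k := 6) (by norm_num) (by norm_num) (by omega) (by omega)]; norm_num [brVal4]
  · rw [depL_well (by omega) (by omega)]; norm_num [brVal4]
  · rw [depL_well (by omega) (by omega)]; norm_num [brVal4]
  · rw [depL_well (by omega) (by omega)]; norm_num [brVal4]
  · rw [depL_well (by omega) (by omega)]; norm_num [brVal4]
  · rw [depL_well (by omega) (by omega)]; norm_num [brVal4]
  · rw [depL_well (by omega) (by omega)]; norm_num [brVal4]
  · rw [depL_well (by omega) (by omega)]; norm_num [brVal4]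
  · rw [depL_upper (k := 6) (by norm_num) (by norm_num) (by omega) (by omega)]; norm_num [brVal4]
  · rw [depL_upper (k := 5) (by norm_num) (by norm_num) (by omega) (by omega)]; norm_num [brVal4]
  · rw [depL_upper (k := 4) (by norm_num) (by norm_num) (by omega) (by omega)]; norm_num [brVal4]
  · rw [depL_upper (k := 3) (by norm_num) (by norm_num) (by omega) (by omega)]; norm_num [brVal4]
  · rw [depL_upper (k := 2) (by norm_num) (by norm_num) (by omega) (by omega)]; norm_num [brVal4]
  · rw [depL_upper (k := 1) (by norm_num) (by norm_num) (by omega) (by omega)]; norm_num [brVal4]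
  · rw [depL_high (by omega)]; norm_num [brVal4]
  · rw [depL_high (by omega)]; norm_num [brVal4]
  · rw [depL_high (by omega)]; norm_num [brVal4]
  · rw [depL_high (by omega)]; norm_num [brVal4]
  · rw [depL_high (by omega)]; norm_num [brVal4]
  · rw [depL_high (by omega)]; norm_num [brVal4]
  · rw [depL_high (by omega)]; norm_num [brVal4]
  · rw [depL_high (by omega)]; norm_num [brVal4]

/-- The depth profile strictly inside the bracket `β`: `βn < s < βn + n`, `β ≤ 34`. -/
theorem depth_ray4_not_mul {n β s : ℕ} (hβ : β ≤ 34) (h1 : β * n < s) (h2 : s < β * n + n) :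
    1 - (blockCount (bLin (8 * n) (6 * n) n) s : ℤ) = brVal4 β false := by
  interval_cases β
  · rw [depL_low (by omega)]; norm_num [brVal4]
  · rw [depL_low (by omega)]; norm_num [brVal4]
  · rw [depL_low (by omega)]; norm_num [brVal4]
  · rw [depL_low (by omega)]; norm_num [brVal4]
  · rw [depL_low (by omega)]; norm_num [brVal4]
  · rw [depL_low (by omega)]; norm_num [brVal4]
  · rw [depL_low (by omega)]; norm_num [brVal4]
  · rw [depL_low (by omega)]; norm_num [brVal4]
  · rw [depL_lower (k := 1) (by norm_num) (by norm_num) (by omega) (by omega)]; norm_num [brVal4]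
  · rw [depL_lower (k := 2) (by norm_num) (by norm_num) (by omega) (by omega)]; norm_num [brVal4]
  · rw [depL_lower (k := 3) (by norm_num) (by norm_num) (by omega) (by omega)]; norm_num [brVal4]
  · rw [depL_lower (k := 4) (by norm_num) (by norm_num) (by omega) (by omega)]; norm_num [brVal4]
  · rw [depL_lower (k := 5) (by norm_num) (by norm_num) (by omega) (by omega)]; norm_num [brVal4]
  · rw [depL_lower (k := 6) (by norm_num) (by norm_num) (by omega) (by omega)]; norm_num [brVal4]
  · rw [depL_well (by omega) (by omega)]; norm_num [brVal4]
  · rw [depL_well (by omega) (by omega)]; norm_num [brVal4]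
  · rw [depL_well (by omega) (by omega)]; norm_num [brVal4]
  · rw [depL_well (by omega) (by omega)]; norm_num [brVal4]
  · rw [depL_well (by omega) (by omega)]; norm_num [brVal4]
  · rw [depL_well (by omega) (by omega)]; norm_num [brVal4]
  · rw [depL_upper (k := 6) (by norm_num) (by norm_num) (by omega) (by omega)]; norm_num [brVal4]
  · rw [depL_upper (k := 5) (by norm_num) (by norm_num) (by omega) (by omega)]; norm_num [brVal4]
  · rw [depL_upper (k := 4) (by norm_num) (by norm_num) (by omega) (by omega)]; norm_num [brVal4]
  · rw [depL_upper (k := 3) (by norm_num) (by norm_num) (by omega) (by omega)]; norm_num [brVal4]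
  · rw [depL_upper (k := 2) (by norm_num) (by norm_num) (by omega) (by omega)]; norm_num [brVal4]
  · rw [depL_upper (k := 1) (by norm_num) (by norm_num) (by omega) (by omega)]; norm_num [brVal4]
  · rw [depL_high (by omega)]; norm_num [brVal4]
  · rw [depL_high (by omega)]; norm_num [brVal4]
  · rw [depL_high (by omega)]; norm_num [brVal4]
  · rw [depL_high (by omega)]; norm_num [brVal4]
  · rw [depL_high (by omega)]; norm_num [brVal4]
  · rw [depL_high (by omega)]; norm_num [brVal4]
  · rw [depL_high (by omega)]; norm_num [brVal4]
  · rw [depL_high (by omega)]; norm_num [brVal4]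
  · rw [depL_high (by omega)]; norm_num [brVal4]

/-- **`netExp (bLin (8n) (6n) n) s = brVal4 ⌊s/n⌋ [n ∣ s] + [2s = 34n]`** for `s ≤ 34n`, `n ≥ 1`. -/
theorem netExp_ray4_eq {n s : ℕ} (hn : 1 ≤ n) (hs : s ≤ 34 * n) :
    netExp (bLin (8 * n) (6 * n) n) s = brVal4 (s / n) (decide (s % n = 0)) + (if 2 * s = 34 * n then 1 else 0) := by
  rw [netExp_bLin]
  have hcen : (2 * s = 2 * (8 * n) + 12 * n + 6 * n) ↔ (2 * s = 34 * n) := by omega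
  simp only [hcen]
  congr 1
  have hmod : n * (s / n) + s % n = s := Nat.div_add_mod s n
  have hlt : s % n < n := Nat.mod_lt s (by omega)
  have hβ : s / n ≤ 34 := by
    apply Nat.div_le_of_le_mul; linarith
  generalize hb : s / n = β at hmod hβ
  rcases Nat.eq_zero_or_pos (s % n) with hr | hr
  · have hsn : s = β * n := by nlinarith [hmod]
    rw [hr, hsn]
    simpa using depth_ray4_mul hn hβ
  · have hdec : decide (s % n = 0) = false := by rw [decide_eq_false_iff_not]; omega
    rw [hdec]
    exact depth_ray4_not_mul hβ (by nlinarith [hmod]) (by nlinarith [hmod])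

end Summit.KontsevichZagierPeriods.Zeta5Search.Ray4Windows
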